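import Summits.CriticalPhenomena.SAWScalingLimit.Theorems.SAWDevelopingMapHexConjectureArchTailSummed
import Literature.Probability.RandomPlanarGeometry.HexSAWBridgeDecay
import HarnessLib

/-!
# Crux `HexConjecture` (stmt-CriticalPhenomena-0808), line `root-locality-replaces-loewner`:
the CUBE version of the window two-point lower bound

Landing target:
`Summits/CriticalPhenomena/SAWScalingLimit/Theorems/SAWDevelopingMapHexConjectureWindowMassCube.lean`
(`--supports stmt-CriticalPhenomena-0808`).

The line's lever is the WINDOW TWO-POINT LOWER BOUND: the `x_c`-mass of the critical half-plane
self-avoiding arches from the vertical floor mid-edge `s_x = {(x - e₁, 1), (x, 0)}` to the floor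
mid-edges `t_{x + d e₀}` at the offsets `d` of a window `[θ_a R, θ_b R]`, inside the upper half-box
`B_R(x) = {v : rows ≥ x₁, |c_v - mid s_x| ≤ R}` and summed over the window, dominates the
Glazman–Manolescu triangle tail `triDl` at the comparable scale.  Glazman–Manolescu's gluing of three
triangle walks (`HV.key_ineq`, the displayed chain of §4.1) gives the CUBE version of this bound once
the glued arcs of the strip `S_{9L+1,9L+1}` are controlled by the coded floor-arch sums of that strip
in the right window `d ∈ [L + 1, 9L + 1]`; the latter control is the sibling registered stub
`stub_arcsIn_sum_le_windowCoded`, taken here INLINE as the hypothesis.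

* `stub_triDl_cube_le_windowMass_of_coded` (registered): from that hypothesis, for `R ≥ 40`,
  `L = ⌊R/40⌋`, every cell `x`, the half-box `B = B_R(x)` and the lattice window
  `S' = [R/40, R/4] ∩ ℤ`:  `triDl (4L)³ ≤ Σ_{d ∈ S'} Z_B(s_x → t_{x + d e₀})`.

Proof: `key_ineq L` with `T' = L'' = 9L + 1`; the hypothesis; each coded sum at offset `d`,
`|d| ≤ 9L + 1`, is the arch mass `Z_{S_x(9L)}(s_x → t_{x + d e₀})` of the half-strip
`S_x(9L) = Φ_x⁻¹ V(S_{9L+1,9L+1})` (`archMass_halfStrip_offset`); `S_x(9L) ⊆ B` because its vertices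
lie in the rows `≥ x₁` within distance `36L + 4 ≤ R` of `mid s_x` (`halfStrip_geometry`), so
`Z_{S_x(9L)} ≤ Z_B` (`archMass_mono`, exact restriction); finally `[L + 1, 9L + 1] ⊆ S'` for
`R ≥ 40` and the arch masses are nonnegative.
-/

noncomputable section

open scoped BigOperators Topology Classical
open Filter Set
open Literature.Probability.LatticeModels (HexVertex hexGraph hexCenter Site)
open Literature.Probability.RandomPlanarGeometry
open Literature.Probability.RandomPlanarGeometry.SAW
open Literature.Probability.RandomPlanarGeometry.SAW.HV
open Summit.CriticalPhenomena.SAWScalingLimit.Theorems.ObservableToSLE.FloorRatio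

namespace Summit.CriticalPhenomena.SAWScalingLimit.Theorems.HexConjecture.RootLocality

/-- **The half-strip `S_x(9L)` lies in the upper half-box of radius `R`** as soon as
`36 L + 4 ≤ R`: its vertices are in the rows `≥ x₁` within distance `4 · 9L + 4` of `mid s_x`
(`halfStrip_geometry`). [cite: DuminilCopinSmirnov2012, §3] -/
theorem cube_halfStrip_subset_halfBox (x : Site 2) (L : ℕ) {R : ℝ} (hR : 36 * (L : ℝ) + 4 ≤ R)
    {B : Finset HexVertex}
    (hB : ∀ v : HexVertex, v ∈ B ↔ (x 1 ≤ v.1 1 ∧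
      dist (hexCenter v) (hexMidpoint s((x - Pi.single 1 1, 1), (x, 0))) ≤ R)) :
    (stripV (9 * L + 1) (9 * L + 1)).map
        (hvIso.trans (shift (-(x 0)) (-(x 1)))).symm.toEquiv.toEmbedding ⊆ B := by
  intro w hw
  have hg := halfStrip_geometry (x := x) (N := 9 * L) hw
  rw [hB]
  refine ⟨hg.1, hg.2.trans ?_⟩
  push_cast
  linarith

/-- **The right window `[L + 1, 9L + 1]` lies in the lattice window `[R/40, R/4]`** for
`L = ⌊R/40⌋` and `R ≥ 40`. [folklore] -/
theorem cube_Icc_subset_window {R : ℝ} (hR : 40 ≤ R) {S' : Finset ℤ}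
    (hS' : ∀ d : ℤ, d ∈ S' ↔ ((1 / 40 : ℝ) * R ≤ (d : ℝ) ∧ (d : ℝ) ≤ (1 / 4 : ℝ) * R)) :
    Finset.Icc ((⌊R / 40⌋₊ : ℤ) + 1) (9 * (⌊R / 40⌋₊ : ℤ) + 1) ⊆ S' := by
  intro d hd
  rw [Finset.mem_Icc] at hd
  rw [hS']
  have hL1 : ((⌊R / 40⌋₊ : ℕ) : ℝ) ≤ R / 40 := Nat.floor_le (by positivity)
  have hL2 : R / 40 < ((⌊R / 40⌋₊ : ℕ) : ℝ) + 1 := Nat.lt_floor_add_one _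
  have h1 : (((⌊R / 40⌋₊ : ℤ) + 1 : ℤ) : ℝ) ≤ (d : ℝ) := by exact_mod_cast hd.1
  have h2 : (d : ℝ) ≤ ((9 * (⌊R / 40⌋₊ : ℤ) + 1 : ℤ) : ℝ) := by exact_mod_cast hd.2
  push_cast at h1 h2
  constructor
  · linarith
  · linarith

/-- **Registered sub-goal `stub_triDl_cube_le_windowMass_of_coded`** (crux item
stmt-CriticalPhenomena-0808, line `root-locality-replaces-loewner`): the CUBE version of the window
two-point lower bound.  If, for every `L`, the `x_c`-mass of the Glazman–Manolescu glued arcs of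
`S_{9L+1,9L+1}` exiting in the columns `[-9L - 1, -L - 1]` is bounded by the coded floor-arch sums of
that strip over the right window `d ∈ [L + 1, 9L + 1]` (the sibling stub
`stub_arcsIn_sum_le_windowCoded`, stated inline), then for every `R ≥ 40`, every cell `x`, the upper
half-box `B = {v : rows ≥ x₁, |c_v - mid s_x| ≤ R}` and the lattice window `S' = [R/40, R/4] ∩ ℤ`,
`triDl (4 ⌊R/40⌋)³ ≤ Σ_{d ∈ S'} Z_B(s_x → t_{x + d e₀})` — by `key_ineq`, translation invariance
(`archMass_halfStrip_offset`), exact restriction (`archMass_mono`, `S_x(9L) ⊆ B`) and the inclusion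
of the windows. [cite: GlazmanManolescu2019, §4.1 (proof of Prop. 1.1)] -/
theorem stub_triDl_cube_le_windowMass_of_coded :
    (∀ (L : ℕ),
      ∑ Q ∈ Literature.Probability.RandomPlanarGeometry.SAW.HV.arcsIn (9 * L + 1) (9 * L + 1) L,
          Literature.Probability.RandomPlanarGeometry.SAW.hexCriticalFugacity ^
            Literature.Probability.RandomPlanarGeometry.SAW.HV.mwLen Q ≤
        ∑ d ∈ Finset.Icc ((L : ℤ) + 1) (9 * (L : ℤ) + 1),
          ∑ P ∈ (Literature.Probability.RandomPlanarGeometry.SAW.HV.midWalks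
              (Literature.Probability.RandomPlanarGeometry.SAW.HV.stripV (9 * L + 1) (9 * L + 1))).filter
              (fun P => Literature.Probability.RandomPlanarGeometry.SAW.HV.finalDart P =
                  ((d, 0, false), (d, -1, true)) ∨
                Literature.Probability.RandomPlanarGeometry.SAW.HV.finalDart P =
                  ((d, -1, true), (d, 0, false))),
            Literature.Probability.RandomPlanarGeometry.SAW.hexCriticalFugacity ^
              Literature.Probability.RandomPlanarGeometry.SAW.HV.mwLen P) →
    ∀ R : ℝ, 40 ≤ R →
    ∀ (x : Literature.Probability.LatticeModels.Site 2)
      (B : Finset Literature.Probability.LatticeModels.HexVertex) (S' : Finset ℤ),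
      (∀ v : Literature.Probability.LatticeModels.HexVertex, v ∈ B ↔ (x 1 ≤ v.1 1 ∧
        dist (Literature.Probability.LatticeModels.hexCenter v)
          (Literature.Probability.RandomPlanarGeometry.SAW.hexMidpoint
            s((x - Pi.single 1 1, 1), (x, 0))) ≤ R)) →
      (∀ d : ℤ, d ∈ S' ↔ ((1 / 40 : ℝ) * R ≤ (d : ℝ) ∧ (d : ℝ) ≤ (1 / 4 : ℝ) * R)) →
      Literature.Probability.RandomPlanarGeometry.SAW.HV.triDl (4 * ⌊R / 40⌋₊) ^ 3 ≤
        ∑ d ∈ S', ∑ γ : Literature.Probability.RandomPlanarGeometry.SAW.HexMidEdgeSAW B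
          s((x - Pi.single 1 1, 1), (x, 0))
          s((x + Pi.single 0 d - Pi.single 1 1, 1), (x + Pi.single 0 d, 0)),
          Literature.Probability.RandomPlanarGeometry.SAW.hexCriticalFugacity ^ γ.length := by
  intro hcoded R hR x B S' hB hS'
  have hwin := cube_Icc_subset_window hR hS'
  set L : ℕ := ⌊R / 40⌋₊ with hLdef
  have hL1 : (L : ℝ) ≤ R / 40 := Nat.floor_le (by positivity)
  -- the half-strip `S_x(9L)` and its inclusion in the half-box
  set HS := (stripV (9 * L + 1) (9 * L + 1)).map
    (hvIso.trans (shift (-(x 0)) (-(x 1)))).symm.toEquiv.toEmbedding with hHS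
  have hsub : HS ⊆ B := cube_halfStrip_subset_halfBox x L (by linarith) hB
  set s : Sym2 HexVertex := s((x - Pi.single 1 1, 1), (x, 0)) with hs
  calc triDl (4 * L) ^ 3
      ≤ ∑ Q ∈ arcsIn (9 * L + 1) (9 * L + 1) L, hexCriticalFugacity ^ mwLen Q :=
        key_ineq L (by omega) le_rfl
    _ ≤ ∑ d ∈ Finset.Icc ((L : ℤ) + 1) (9 * (L : ℤ) + 1),
          ∑ P ∈ (midWalks (stripV (9 * L + 1) (9 * L + 1))).filter
              (fun P => finalDart P = ((d, 0, false), (d, -1, true)) ∨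
                finalDart P = ((d, -1, true), (d, 0, false))),
            hexCriticalFugacity ^ mwLen P := hcoded L
    _ = ∑ d ∈ Finset.Icc ((L : ℤ) + 1) (9 * (L : ℤ) + 1),
          ∑ γ : HexMidEdgeSAW HS s
            s((x + Pi.single 0 d - Pi.single 1 1, 1), (x + Pi.single 0 d, 0)),
            hexCriticalFugacity ^ γ.length := by
        refine Finset.sum_congr rfl fun d hd => ?_
        rw [Finset.mem_Icc] at hd
        have hd' : |d| ≤ ((9 * L : ℕ) : ℤ) + 1 := by
          rw [abs_le]; push_cast; constructor <;> omega
        exact (archMass_halfStrip_offset x (9 * L) d hd').symm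
    _ ≤ ∑ d ∈ Finset.Icc ((L : ℤ) + 1) (9 * (L : ℤ) + 1),
          ∑ γ : HexMidEdgeSAW B s
            s((x + Pi.single 0 d - Pi.single 1 1, 1), (x + Pi.single 0 d, 0)),
            hexCriticalFugacity ^ γ.length :=
        Finset.sum_le_sum fun d _ => archMass_mono hsub s _
    _ ≤ ∑ d ∈ S', ∑ γ : HexMidEdgeSAW B s
            s((x + Pi.single 0 d - Pi.single 1 1, 1), (x + Pi.single 0 d, 0)),
            hexCriticalFugacity ^ γ.length :=
        Finset.sum_le_sum_of_subset_of_nonneg hwin fun d _ _ => archMass_nonneg _ _ _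

end Summit.CriticalPhenomena.SAWScalingLimit.Theorems.HexConjecture.RootLocality

end
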